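import Summits.BirchSwinnertonDyer.BirchSwinnertonDyer.Theorems.PrintCf2SplitBadTwoFirstLayerRamifiedAtVbar
import HarnessLib

/-!
# Crux `PrintCf2.SplitBadTwoRankOneOfFacts` (stmt-BirchSwinnertonDyer-20368), road α v10.3 — brick B15 §2, file 6:
# EULER'S CRITERION ON A FROBENIUS: an odd place `w` with `γ^{(Nw−1)/2} ≡ −1 (mod w)` is INERT in `K(√γ)` — the door for (C1) at the odd `w ∣ d`

Cell `bsd-print-cf2`, width seat `bsd-line-cf2-p1-w6` g2 (prover-bsd-line-cf2-p1-w6-g2-0); `--supports stmt-BirchSwinnertonDyer-20368`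
(helper, Theses-free). HONEST FRAMING: nothing here closes the crux or a registered stub; BSD is not proved by any of this; no summit
statement is proved by this seat. No definition, no named fact, no `sorry`.

WHAT. File 4 computed the Frobenius at `w₇` on `√−β` by hand (`N w₇ = 7`). The same argument at ANY finite place `w ∤ 2` of ANY number
field `K`, for ANY `γ ∈ 𝓞_K` prime to `w`: if `γ^m + 1 ∈ w` with `N w = 2m + 1` (Euler: `γ` is a quadratic NON-residue mod `w`), then an
arithmetic Frobenius `σ` at `𝔓₀(w)` — an element of `decomp w` — sends `√γ ↦ −√γ` (`σ√γ ≡ (√γ)^{Nw} = γ^m √γ ≡ −√γ (mod 𝔓₀)`, and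
`σ√γ = √γ` would put `4γ ∈ w`):
* **`exists_mem_decomp_smul_geomSqrt_eq_neg_of_pow_add_one_mem`** — the generic door (tree Frobenius `exists_isArithFrobAt_of_mem_primesAbove_holds`,
  Mathlib `IsArithFrobAt.mem_stabilizer`, the tree's `decompositionSubgroup_adicCompletionPrime_eq_range`); the tree had this only over `ℚ`
  (`IsRationalCharacterFor.coe_apply_eq_jacobiSym_of_isArithFrobAt`, Gross-2004 dictionary);
* `not_decomp_le_stabilizer_geomSqrt_of_pow_add_one_mem` — `¬ D_w ≤ Stab(√γ)`: `w` does not split in `K(√γ)`;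
* ROAD α: **`not_decomp_le_kerSubgroup_of_frame_of_pow_add_one_mem`** — on every S3c₂ frame and for every `ℤ₂`-line `κ` unramified outside
  `v̄`: an odd place `w` at which `−β` is a non-residue (`(−β)^m + 1 ∈ w`, `N w = 2m+1`) satisfies `¬ D_w ≤ κ⁻¹(2ℤ₂)`, hence
  **`¬ D_w ≤ ker κ`** — (R-CFT / C1) of the S3c₂ assembly at every such `w ∣ d`, with no class field theory (first layer `K(√−β)`, file 3b).
  (At the odd `w ∣ d` where `−β` IS a residue, `w` splits in `K₁` and (C1) is a statement about higher layers — genuinely CFT.)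
presearch: Neukirch ANT I (8.3) + (9.4) (decomposition of `p` in `K(√a)` via Euler/Frobenius), Marcus Ch. 4 Thm. 33 — held; no new fact.
beyond-print theorem: no.

References: [NeukirchANT1999] Ch. I §8 Prop. (8.3), §9 Prop. (9.4); [Marcus2018] Ch. 4 Thm. 33; [SerreAbelianLadic1968] Ch. I §2.1;
[Agboola2007] §3 Prop. 3.2.
-/

noncomputable section

open scoped Classical NumberField Pointwise

set_option linter.dupNamespace false
set_option autoImplicit false

open NumberField IsDedekindDomain Field WeierstrassCurve
open Literature.NumberTheory Literature.NumberTheory.EllipticCurves Literature.NumberTheory.GaloisRepresentations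

namespace Summit.BirchSwinnertonDyer.BirchSwinnertonDyer.Theorems.PrintCf2.FirstLayer

variable {K : Type} [Field K] [NumberField K]

/-! ## §1. Euler's criterion on an arithmetic Frobenius (any number field, any odd place) -/

section Euler

/-- **EULER'S CRITERION ON A FROBENIUS.** `K` any number field, `w ∤ 2` a finite place with `N w = 2m + 1`, `γ ∈ 𝓞_K` with `γ ∉ w` and
`γ^m + 1 ∈ w` (a quadratic non-residue mod `w`). Then some `δ ∈ decomp w` — an arithmetic Frobenius at `𝔓₀ = adicCompletionPrime K w` —
sends `√γ ↦ −√γ`: `σ√γ ≡ (√γ)^{N w} = γ^m·√γ ≡ −√γ (mod 𝔓₀)`, and `σ√γ = √γ` would force `2√γ ∈ 𝔓₀`, `4γ ∈ 𝔓₀ ∩ 𝓞_K = w`.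
[cite: NeukirchANT1999, Ch. I §8 Prop. (8.3) and §9 Prop. (9.4)] [cite: SerreAbelianLadic1968, Ch. I §2.1] -/
theorem exists_mem_decomp_smul_geomSqrt_eq_neg_of_pow_add_one_mem {w : HeightOneSpectrum (𝓞 K)} {m : ℕ}
    (hq : w.residueCard = 2 * m + 1) (h2 : (2 : 𝓞 K) ∉ w.asIdeal) {γ : 𝓞 K} (hγw : γ ∉ w.asIdeal)
    (hγ : γ ^ m + 1 ∈ w.asIdeal) :
    ∃ δ ∈ GreenbergSelmer.decomp w, δ • geomSqrt (γ : K) = -geomSqrt (γ : K) := by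
  set 𝔓 := adicCompletionPrime K w with h𝔓def
  have h𝔓 : 𝔓 ∈ w.primesAbove := adicCompletionPrime_mem_primesAbove K w
  obtain ⟨σ, hσ⟩ := HeightOneSpectrum.exists_isArithFrobAt_of_mem_primesAbove_holds (K := K) (v := w) h𝔓
  have hσD : σ ∈ GreenbergSelmer.decomp w := by
    have hstab : σ ∈ MulAction.stabilizer (absoluteGaloisGroup K) 𝔓 := hσ.mem_stabilizer
    have e : GreenbergSelmer.decomp w = 𝔓.decompositionSubgroup (absoluteGaloisGroup K) := by
      rw [h𝔓def, decompositionSubgroup_adicCompletionPrime_eq_range]; rfl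
    rw [e]
    exact hstab
  refine ⟨σ, hσD, ?_⟩
  set x : AlgebraicClosure K := geomSqrt (γ : K) with hxdef
  have hx2 : x ^ 2 = algebraMap (𝓞 K) (AlgebraicClosure K) γ := by
    rw [hxdef, geomSqrt_sq, IsScalarTower.algebraMap_apply (𝓞 K) K (AlgebraicClosure K)]
  have hxint : x ∈ absIntegers (𝓞 K) K := by
    rw [absIntegers, mem_integralClosure_iff]
    exact IsIntegral.of_pow two_pos (by rw [hx2]; exact isIntegral_algebraMap)
  set X : absIntegers (𝓞 K) K := ⟨x, hxint⟩ with hXdef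
  have hfrob : σ • X - X ^ (2 * m + 1) ∈ 𝔓 := by
    have h := (HeightOneSpectrum.isArithFrobAt_iff_of_mem_primesAbove h𝔓 σ).mp hσ X
    rwa [hq] at h
  have hmemP : ∀ y : 𝓞 K, y ∈ w.asIdeal → algebraMap (𝓞 K) (absIntegers (𝓞 K) K) y ∈ 𝔓 := fun y hy ↦ by
    have h : y ∈ 𝔓.under (𝓞 K) := by rw [under_adicCompletionPrime]; exact hy
    exact h
  have hX2 : X ^ 2 = algebraMap (𝓞 K) (absIntegers (𝓞 K) K) γ := by
    apply Subtype.ext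
    change x ^ 2 = algebraMap (𝓞 K) (AlgebraicClosure K) γ
    exact hx2
  have hqX : X ^ (2 * m + 1) + X ∈ 𝔓 := by
    have e : X ^ (2 * m + 1) + X = X * algebraMap (𝓞 K) (absIntegers (𝓞 K) K) (γ ^ m + 1) := by
      rw [map_add, map_pow, map_one, ← hX2]
      ring
    rw [e]
    exact 𝔓.mul_mem_left _ (hmemP _ hγ)
  have hsum : σ • X + X ∈ 𝔓 := by
    have e : σ • X + X = (σ • X - X ^ (2 * m + 1)) + (X ^ (2 * m + 1) + X) := by ring
    rw [e]
    exact 𝔓.add_mem hfrob hqX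
  rcases smul_geomSqrt_eq_or σ (γ : K) with hfix | hneg
  · exfalso
    have h2X : (2 : absIntegers (𝓞 K) K) * X ∈ 𝔓 := by
      have e : (2 : absIntegers (𝓞 K) K) * X = σ • X + X := by
        rw [two_mul]
        congr 1
        apply Subtype.ext
        change x = σ • x
        exact hfix.symm
      rw [e]; exact hsum
    have h4γ : algebraMap (𝓞 K) (absIntegers (𝓞 K) K) (4 * γ) ∈ 𝔓 := by
      have e : algebraMap (𝓞 K) (absIntegers (𝓞 K) K) (4 * γ) = (2 * X) * (2 * X) := by
        rw [show (2 * X) * (2 * X) = 4 * X ^ 2 by ring, hX2, map_mul]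
        simp only [map_ofNat]
      rw [e]
      exact 𝔓.mul_mem_left _ h2X
    have h4γ' : 4 * γ ∈ 𝔓.under (𝓞 K) := h4γ
    rw [under_adicCompletionPrime] at h4γ'
    rcases w.isPrime.mem_or_mem h4γ' with h4 | hg
    · apply h2
      have : (4 : 𝓞 K) = 2 * 2 := by norm_num
      rw [this] at h4
      exact (w.isPrime.mem_or_mem h4).elim id id
    · exact hγw hg
  · exact hneg

/-- **`w` does not split in `K(√γ)`**: under Euler's non-residue criterion, `¬ D_w ≤ Stab(√γ)`. [cite: NeukirchANT1999, Ch. I §8 Prop. (8.3)] -/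
theorem not_decomp_le_stabilizer_geomSqrt_of_pow_add_one_mem {w : HeightOneSpectrum (𝓞 K)} {m : ℕ}
    (hq : w.residueCard = 2 * m + 1) (h2 : (2 : 𝓞 K) ∉ w.asIdeal) {γ : 𝓞 K} (hγw : γ ∉ w.asIdeal)
    (hγ : γ ^ m + 1 ∈ w.asIdeal) :
    ¬ GreenbergSelmer.decomp w ≤ MulAction.stabilizer (absoluteGaloisGroup K) (geomSqrt (γ : K)) := by
  obtain ⟨δ, hδ, hδγ⟩ := exists_mem_decomp_smul_geomSqrt_eq_neg_of_pow_add_one_mem hq h2 hγw hγ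
  intro hle
  have hfix : δ • geomSqrt (γ : K) = geomSqrt (γ : K) := MulAction.mem_stabilizer_iff.mp (hle hδ)
  have hγ0 : (γ : K) ≠ 0 := by
    intro h
    have hg : γ = 0 := by exact_mod_cast h
    exact hγw (hg ▸ w.asIdeal.zero_mem)
  rw [hfix] at hδγ
  exact geomSqrt_ne_neg hγ0 hδγ

end Euler

/-! ## §2. Road α: (C1) at every odd place where `−β` is a non-residue -/

section Frame

/-- **(R-CFT / C1) AT THE ODD PLACES WHERE `−β` IS A NON-RESIDUE.** On every frame (`K` imaginary quadratic, `θ² = −7`, member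
`C • W = cm7^{(d)}`, `2 = v v̄`, `β(1−β) = 2`, `β ∈ v̄`) and for every `ℤ₂`-line `κ` unramified outside `v̄`: a finite place `w ∌ 2` with
`N w = 2m + 1`, `β ∉ w` and `(−β)^m + 1 ∈ w` does NOT split completely in the first layer (`¬ D_w ≤ κ⁻¹(2ℤ₂) = Stab(√−β)`), hence not in the
line: **`¬ D_w ≤ ker κ`**. [cite: NeukirchANT1999, Ch. I §8 Prop. (8.3)] [cite: Agboola2007, §3 Prop. 3.2] -/
theorem not_decomp_le_kerSubgroup_of_frame_of_pow_add_one_mem (hK : IsImaginaryQuadratic K) {θ : K} (hθ : θ ^ 2 = -7) {d : ℤ}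
    (hd0 : d ≠ 0) (W : WeierstrassCurve ℚ) [W.IsElliptic] {C : VariableChange ℚ} (hC : C • W = cm7.quadraticTwist (d : ℚ))
    {v vbar : HeightOneSpectrum (𝓞 K)} (hv : ((2 : ℕ) : 𝓞 K) ∈ v.asIdeal) (hvbar : ((2 : ℕ) : 𝓞 K) ∈ vbar.asIdeal)
    (hne : vbar ≠ v) {β : 𝓞 K} (hβ : β * (1 - β) = 2) (hβvbar : β ∈ vbar.asIdeal)
    (κ : ZpExtension K 2) (hκ : κ.IsUnramifiedOutside vbar) {w : HeightOneSpectrum (𝓞 K)} {m : ℕ}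
    (hq : w.residueCard = 2 * m + 1) (h2 : (2 : 𝓞 K) ∉ w.asIdeal) (hβw : β ∉ w.asIdeal) (hres : (-β) ^ m + 1 ∈ w.asIdeal) :
    ¬ GreenbergSelmer.decomp w ≤ κ.layerSubgroup 1 ∧ ¬ GreenbergSelmer.decomp w ≤ κ.kerSubgroup := by
  have hβw' : -β ∉ w.asIdeal := fun h ↦ hβw (by simpa using w.asIdeal.neg_mem h)
  obtain ⟨δ, hδ, hδβ⟩ := exists_mem_decomp_smul_geomSqrt_eq_neg_of_pow_add_one_mem hq h2 hβw' hres
  have hβ0 : (((-β : 𝓞 K)) : K) ≠ 0 := by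
    intro h
    have hb : -β = 0 := by exact_mod_cast h
    exact hβw' (hb ▸ w.asIdeal.zero_mem)
  have hmove : ∃ δ ∈ GreenbergSelmer.decomp w, δ • geomSqrt (-(β : K)) ≠ geomSqrt (-(β : K)) := by
    refine ⟨δ, hδ, ?_⟩
    have e : (-(β : K)) = (((-β : 𝓞 K)) : K) := by push_cast; ring
    rw [e, hδβ]
    exact (geomSqrt_ne_neg hβ0).symm
  have h1 := not_decomp_le_layerSubgroup_one_of_exists_smul_ne hK hθ hd0 W hC hv hvbar hne hβ hβvbar κ hκ hmove
  exact ⟨h1, fun hle ↦ h1 (hle.trans (κ.kerSubgroup_le_layerSubgroup 1))⟩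

end Frame

end Summit.BirchSwinnertonDyer.BirchSwinnertonDyer.Theorems.PrintCf2.FirstLayer

end
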